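import Literature.NumberTheory.NumberFields.CubicField14483Ideals
import HarnessLib

/-!
# The cubic field of discriminant `-14483`, VI: the degree-two primes `𝔮₂ = (2, γ² + γ + 1)`, `𝔮₅ = (5, γ² + 2γ + 3)`;
# `(2) = 𝔭₂ 𝔮₂`, `(5) = 𝔭₅ 𝔮₅`, `(-30 - 19γ + δ) = 𝔮₅ · 𝔭₂⁵`

Sixth file on the `2`-division field `K = ℚ(γ)` of `E_{28/9}`. The primes of residue degree `2` above `2` and `5`
(`f ≡ X(X² + X + 1) (mod 2)`, `f ≡ (X - 3)(X² + 2X + 3) (mod 5)`) are not kernels of maps to `ℤ/p`; they are handled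
directly by Dedekind–Kummer (Mathlib `NumberField.Ideal.primesOverSpanEquivMonicFactorsMod`, Marcus Ch. 3 Thm. 27) in
the explicit form `(p, Q(θ))`:

* §1 (generic, `MonicCubic`) `span_mem_primesOver_of_factor` — an irreducible monic factor `Q̄` of `f mod p`
  (`p ∤ exponent θ`) gives the prime `(p, Q(θ)) ∈ primesOver p` of residue degree `deg Q̄` and norm `p^{deg Q̄}`; the shape
  `f ≡ (X - r)(X² + sX + t) (mod p)` with the quadratic irreducible (`polyMod_eq_lin_mul_quad_of`, Vieta):
  `eq_span_of_polyMod_eq_lin_mul_quad` — every prime above `p` is `(p, θ - r)` or `(p, θ² + sθ + t)` — and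
  `span_quad_mem_primesOver` — the latter is a prime above `p` of norm `p²`.
* §2 `K` at `2`: `𝔮₂ = (2, γ² + γ + 1)` is a prime above `2` of norm `4`, the primes above `2` are `(2, γ)` and `𝔮₂`,
  and **`(2) = (2, γ) · 𝔮₂`** (the `S`-unit `2`).
* §3 `K` at `5`: `𝔮₅ = (5, γ² + 2γ + 3)` has norm `25`, the primes above `5` are `(5, γ - 3)` and `𝔮₅`,
  and the class-group witness **`(-30 - 19γ + δ) = 𝔮₅ · 𝔭₂⁵`** (membership in `𝔮₅` by the explicit combination
  `-30 - 19γ + δ = 5(-132 - 62γ + 11δ) + (γ² + 2γ + 3)(-8 - 8γ - 7δ)`, in `𝔭₂⁵` by the residue map mod `32`, norm `-800`).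

Everything is proved; theorems only. With `CubicField14483Ideals/Witnesses` this completes the list: EVERY prime of `K` of
norm `≤ 34` (the Minkowski bound) is `~ 𝔭₂ʲ` in the class group (`Cl(K) = ⟨[𝔭₂]⟩ ≅ ℤ/8`, assembled in the sequel).

## References
* [Marcus2018] D. A. Marcus, *Number Fields*, 2nd ed. (2018), Ch. 3, Thm. 22, Thm. 27; Ch. 5, Thm. 35.
-/

noncomputable section

open Polynomial Module NumberField Ideal
open scoped NumberField

namespace Literature.NumberTheory.NumberFields

namespace MonicCubic

variable {K : Type*} [Field K] [NumberField K] {a b c : ℤ} {θ : K}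

/-! ### §1 Dedekind–Kummer: primes from irreducible factors; the shape linear × irreducible quadratic -/

/-- **An irreducible monic factor `Q̄ ∣ f mod p` gives the prime `(p, Q(θ))` above `p`, of residue degree `deg Q̄` and
norm `p ^ deg Q̄`** (`p ∤ exponent(θ)`). [cite: Marcus2018, Ch. 3, Thm. 27] -/
theorem span_mem_primesOver_of_factor (hirr : Irreducible (polyQ a b c)) (hθ : aeval θ (poly a b c) = 0)
    {p : ℕ} [hp : Fact p.Prime] (hexp : ¬ p ∣ RingOfIntegers.exponent (thetaInt hθ))
    {Qb : (ZMod p)[X]} (hQirr : Irreducible Qb) (hQmon : Qb.Monic) (hQdvd : Qb ∣ polyMod a b c p)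
    (Q : ℤ[X]) (hQ : Q.map (Int.castRingHom (ZMod p)) = Qb) :
    span {(p : 𝓞 K), aeval (thetaInt hθ) Q} ∈ primesOver (span {(p : ℤ)}) (𝓞 K) ∧
      (span {(p : 𝓞 K), aeval (thetaInt hθ) Q}).inertiaDeg ℤ = Qb.natDegree ∧
      absNorm (span {(p : 𝓞 K), aeval (thetaInt hθ) Q}) = p ^ Qb.natDegree := by
  have h0 : polyMod a b c p ≠ 0 := (monic_polyMod a b c p).ne_zero
  have hmem : Q.map (Int.castRingHom (ZMod p)) ∈ RingOfIntegers.monicFactorsMod (thetaInt hθ) p := by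
    simp only [RingOfIntegers.monicFactorsMod, Multiset.mem_toFinset, minpoly_thetaInt hirr hθ]
    rw [hQ]
    exact (Polynomial.mem_normalizedFactors_iff h0).mpr ⟨hQirr, hQmon, hQdvd⟩
  have hspan := NumberField.Ideal.primesOverSpanEquivMonicFactorsMod_symm_apply_eq_span hexp hmem
  have hdeg := NumberField.Ideal.inertiaDeg_primesOverSpanEquivMonicFactorsMod_symm_apply hexp hmem
  rw [hspan, hQ] at hdeg
  have hP : span {(p : 𝓞 K), aeval (thetaInt hθ) Q} ∈ primesOver (span {(p : ℤ)}) (𝓞 K) := by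
    rw [← hspan]; exact ((NumberField.Ideal.primesOverSpanEquivMonicFactorsMod hexp).symm ⟨_, hmem⟩).2
  refine ⟨hP, hdeg, ?_⟩
  haveI := hP.1
  haveI := hP.2
  haveI : (span {(p : 𝓞 K), aeval (thetaInt hθ) Q}).IsMaximal :=
    Ring.DimensionLEOne.maximalOfPrime (by
      intro hbot
      have hmemp := natCast_mem_of_mem_primesOver' (p := p) hP
      rw [hbot, Ideal.mem_bot] at hmemp
      exact hp.out.ne_zero (by exact_mod_cast hmemp)) hP.1
  rw [Ideal.absNorm_eq_pow_inertiaDeg' _ hp.out, Ideal.inertiaDeg'_eq_inertiaDeg, hdeg]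

/-- `f mod p` as a product linear × quadratic, from Vieta: `f ≡ (X - r)(X² + sX + t)` when
`(a, b, c) ≡ (s - r, t - rs, -rt) (mod p)`. [cite: Marcus2018, Ch. 3, Thm. 27 (proof)] -/
theorem polyMod_eq_lin_mul_quad_of {p : ℕ} (r s t : ZMod p)
    (h : (⟨1, (a : ZMod p), (b : ZMod p), (c : ZMod p)⟩ : Cubic (ZMod p)) = ⟨1, s - r, t - r * s, -(r * t)⟩) :
    polyMod a b c p = (X - C r) * (X ^ 2 + C s * X + C t) := by
  rw [polyMod, poly_eq_toPoly, ← Cubic.map_toPoly]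
  have hm : Cubic.map (Int.castRingHom (ZMod p)) ⟨1, a, b, c⟩ = ⟨1, (a : ZMod p), (b : ZMod p), (c : ZMod p)⟩ := by
    simp [Cubic.map]
  rw [hm, h]
  simp only [Cubic.toPoly, C_sub, C_mul, C_neg, C_1, one_mul]
  ring

/-- The monic quadratic `X² + sX + t` has degree `2`. [cite: Marcus2018, Ch. 3, Thm. 27 (proof)] -/
theorem natDegree_quad {F : Type*} [Field F] (s t : F) : (X ^ 2 + C s * X + C t : F[X]).natDegree = 2 := by
  compute_degree!

/-- `X² + sX + t` is monic. [cite: Marcus2018, Ch. 3, Thm. 27 (proof)] -/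
theorem monic_quad {F : Type*} [Field F] (s t : F) : (X ^ 2 + C s * X + C t : F[X]).Monic := by
  unfold Polynomial.Monic
  rw [Polynomial.leadingCoeff, natDegree_quad]
  simp

/-- **A quadratic without roots is irreducible**: `X² + sX + t` over a field `F` with `x² + sx + t ≠ 0` for all `x ∈ F`.
[cite: Marcus2018, Ch. 3, Thm. 27 (proof)] -/
theorem irreducible_quad_of_forall_ne {F : Type*} [Field F] {s t : F} (h : ∀ x : F, x ^ 2 + s * x + t ≠ 0) :
    Irreducible (X ^ 2 + C s * X + C t : F[X]) := by
  refine irreducible_of_degree_le_three_of_not_isRoot ?_ ?_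
  · rw [natDegree_quad]; decide
  · intro x hx
    refine h x ?_
    simpa [IsRoot] using hx

/-- **Dedekind–Kummer for the shape `f ≡ (X - r)(X² + sX + t) (mod p)`** with the quadratic irreducible mod `p`
(`p ∤ exponent(θ)`): every prime of `𝓞 K` above `p` is `(p, θ - r)` or `(p, θ² + sθ + t)`. [cite: Marcus2018, Ch. 3, Thm. 27] -/
theorem eq_span_of_polyMod_eq_lin_mul_quad (hirr : Irreducible (polyQ a b c)) (hθ : aeval θ (poly a b c) = 0)
    {p : ℕ} [hp : Fact p.Prime] (hexp : ¬ p ∣ RingOfIntegers.exponent (thetaInt hθ)) {r s t : ℤ}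
    (hq : ∀ x : ZMod p, x ^ 2 + (s : ZMod p) * x + (t : ZMod p) ≠ 0)
    (hsplit : polyMod a b c p = (X - C (r : ZMod p)) * (X ^ 2 + C (s : ZMod p) * X + C (t : ZMod p)))
    {P : Ideal (𝓞 K)} (hP : P ∈ primesOver (span {(p : ℤ)}) (𝓞 K)) :
    P = span {(p : 𝓞 K), thetaInt hθ - (r : 𝓞 K)} ∨
      P = span {(p : 𝓞 K), thetaInt hθ ^ 2 + (s : 𝓞 K) * thetaInt hθ + (t : 𝓞 K)} := by
  obtain ⟨Qb, hirr', hmon, hdvd, -, hspan⟩ := exists_factor_of_mem_primesOver' hirr hθ hp.out hexp hP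
  have hprime : Prime Qb := hirr'.prime
  rw [hsplit] at hdvd
  rcases hprime.dvd_or_dvd hdvd with h1 | h2
  · left
    have hQb := linear_of_dvd_linear hmon hirr'.natDegree_pos h1
    have h := hspan (X - C r) (by rw [hQb, Polynomial.map_sub, map_X, map_C, eq_intCast])
    simpa [map_sub, aeval_X, aeval_C] using h
  · right
    have hQb : Qb = X ^ 2 + C (s : ZMod p) * X + C (t : ZMod p) :=
      eq_of_monic_of_associated hmon (monic_quad _ _)
        (hirr'.associated_of_dvd (irreducible_quad_of_forall_ne hq) h2)
    have h := hspan (X ^ 2 + C s * X + C t) (by rw [hQb]; simp)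
    simpa [map_add, map_mul, map_pow, aeval_X, aeval_C] using h

/-- **The degree-two prime `(p, θ² + sθ + t)`** in the shape `f ≡ (X - r)(X² + sX + t) (mod p)`, quadratic irreducible,
`p ∤ exponent(θ)`: a prime above `p` of norm `p²`. [cite: Marcus2018, Ch. 3, Thm. 27] -/
theorem span_quad_mem_primesOver (hirr : Irreducible (polyQ a b c)) (hθ : aeval θ (poly a b c) = 0)
    {p : ℕ} [hp : Fact p.Prime] (hexp : ¬ p ∣ RingOfIntegers.exponent (thetaInt hθ)) {r s t : ℤ}
    (hq : ∀ x : ZMod p, x ^ 2 + (s : ZMod p) * x + (t : ZMod p) ≠ 0)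
    (hsplit : polyMod a b c p = (X - C (r : ZMod p)) * (X ^ 2 + C (s : ZMod p) * X + C (t : ZMod p))) :
    span {(p : 𝓞 K), thetaInt hθ ^ 2 + (s : 𝓞 K) * thetaInt hθ + (t : 𝓞 K)} ∈ primesOver (span {(p : ℤ)}) (𝓞 K) ∧
      absNorm (span {(p : 𝓞 K), thetaInt hθ ^ 2 + (s : 𝓞 K) * thetaInt hθ + (t : 𝓞 K)}) = p ^ 2 := by
  have hdvd : (X ^ 2 + C (s : ZMod p) * X + C (t : ZMod p)) ∣ polyMod a b c p :=
    ⟨X - C (r : ZMod p), by rw [hsplit, mul_comm]⟩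
  have e : aeval (thetaInt hθ) (X ^ 2 + C s * X + C t : ℤ[X]) =
      thetaInt hθ ^ 2 + (s : 𝓞 K) * thetaInt hθ + (t : 𝓞 K) := by
    simp [aeval_X]
  obtain ⟨hP, -, hN⟩ := span_mem_primesOver_of_factor hirr hθ hexp (irreducible_quad_of_forall_ne hq) (monic_quad _ _)
    hdvd (X ^ 2 + C s * X + C t) (by simp)
  rw [e] at hP hN
  exact ⟨hP, by rw [hN, natDegree_quad]⟩

/-- **`(p) = 𝔭 · 𝔮`** for two distinct primes `𝔭, 𝔮 ∋ p` with `N(𝔭) N(𝔮) = p ^ [K:ℚ]`. [cite: Marcus2018, Ch. 3, Thm. 22] -/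
theorem span_natCast_eq_mul {p : ℕ} (hp : p ≠ 0) {A B : Ideal (𝓞 K)} (hA : A.IsMaximal) (hB : B.IsMaximal)
    (hne : A ≠ B) (hpA : (p : 𝓞 K) ∈ A) (hpB : (p : 𝓞 K) ∈ B)
    (hN : p ^ finrank ℚ K = absNorm A * absNorm B) : span {(p : 𝓞 K)} = A * B := by
  refine eq_mul_of_le_of_le_of_isCoprime ((span_singleton_le_iff_mem _).mpr hpA)
    ((span_singleton_le_iff_mem _).mpr hpB) (isCoprime_of_isMaximal_ne hA hB hne) ?_ ?_
  · rw [← hN, Ideal.absNorm_span_singleton, show (p : 𝓞 K) = algebraMap ℤ (𝓞 K) (p : ℤ) by simp,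
      Algebra.norm_algebraMap, NumberField.RingOfIntegers.rank]
    simp
  · rw [Ne, span_singleton_eq_bot]; exact_mod_cast hp

end MonicCubic

namespace CubicField14483

open MonicCubic

variable {K : Type*} [Field K] [NumberField K] {γ : K}

/-! ### §2 The primes above `2`: `(2, γ)` and `𝔮₂ = (2, γ² + γ + 1)`; `(2) = (2, γ) · 𝔮₂` -/

/-- `f ≡ X · (X² + X + 1) (mod 2)`. [cite: Marcus2018, Ch. 3, Thm. 27] -/
theorem polyMod_two : polyMod (-1) 27 36 2 =
    (X - C ((0 : ℤ) : ZMod 2)) * (X ^ 2 + C ((1 : ℤ) : ZMod 2) * X + C ((1 : ℤ) : ZMod 2)) :=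
  polyMod_eq_lin_mul_quad_of _ _ _ (by simp only [Cubic.mk.injEq]; decide)

/-- `X² + X + 1` has no root mod `2`. [cite: Marcus2018, Ch. 3, Thm. 27] -/
theorem quad_two_ne_zero : ∀ x : ZMod 2, x ^ 2 + ((1 : ℤ) : ZMod 2) * x + ((1 : ℤ) : ZMod 2) ≠ 0 := by decide

/-- **`𝔮₂ = (2, γ² + γ + 1)` is a prime above `2` of norm `4`** (residue degree `2`). [cite: Marcus2018, Ch. 3, Thm. 27] -/
theorem q2_mem_primesOver (hγ : γ ^ 3 - γ ^ 2 + 27 * γ + 36 = 0) (h3 : finrank ℚ K = 3) :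
    span {((2 : ℕ) : 𝓞 K), thetaInt (aeval_eq hγ) ^ 2 + ((1 : ℤ) : 𝓞 K) * thetaInt (aeval_eq hγ) + ((1 : ℤ) : 𝓞 K)} ∈
        primesOver (span {((2 : ℕ) : ℤ)}) (𝓞 K) ∧
      absNorm (span {((2 : ℕ) : 𝓞 K),
        thetaInt (aeval_eq hγ) ^ 2 + ((1 : ℤ) : 𝓞 K) * thetaInt (aeval_eq hγ) + ((1 : ℤ) : 𝓞 K)}) = 2 ^ 2 := by
  haveI : Fact (Nat.Prime 2) := ⟨Nat.prime_two⟩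
  exact span_quad_mem_primesOver irreducible_polyQ (aeval_eq hγ) (not_dvd_exponent hγ h3 Nat.prime_two (by norm_num))
    quad_two_ne_zero polyMod_two

/-- **The primes above `2` are `𝔭₂ = (2, γ)` and `𝔮₂ = (2, γ² + γ + 1)`.** [cite: Marcus2018, Ch. 3, Thm. 27] -/
theorem eq_span_of_mem_primesOver_two (hγ : γ ^ 3 - γ ^ 2 + 27 * γ + 36 = 0) (h3 : finrank ℚ K = 3)
    {P : Ideal (𝓞 K)} (hP : P ∈ primesOver (span {((2 : ℕ) : ℤ)}) (𝓞 K)) :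
    P = span {((2 : ℕ) : 𝓞 K), thetaInt (aeval_eq hγ) - ((0 : ℤ) : 𝓞 K)} ∨
      P = span {((2 : ℕ) : 𝓞 K),
        thetaInt (aeval_eq hγ) ^ 2 + ((1 : ℤ) : 𝓞 K) * thetaInt (aeval_eq hγ) + ((1 : ℤ) : 𝓞 K)} := by
  haveI : Fact (Nat.Prime 2) := ⟨Nat.prime_two⟩
  exact eq_span_of_polyMod_eq_lin_mul_quad irreducible_polyQ (aeval_eq hγ)
    (not_dvd_exponent hγ h3 Nat.prime_two (by norm_num)) quad_two_ne_zero polyMod_two hP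

/-- **`(2) = 𝔭₂ · 𝔮₂`** with `𝔭₂ = ker ψ₁` for any `ψ₁ : 𝓞 K → ℤ/2` (necessarily `ψ₁(γ) = 0`): the `S`-unit `2` of the
descent. [cite: Marcus2018, Ch. 3, Thm. 22] -/
theorem span_two_eq (hγ : γ ^ 3 - γ ^ 2 + 27 * γ + 36 = 0) (h3 : finrank ℚ K = 3) (ψ₁ : 𝓞 K →+* ZMod 2) :
    span {((2 : ℕ) : 𝓞 K)} = RingHom.ker ψ₁ *
      span {((2 : ℕ) : 𝓞 K), thetaInt (aeval_eq hγ) ^ 2 + ((1 : ℤ) : 𝓞 K) * thetaInt (aeval_eq hγ) + ((1 : ℤ) : 𝓞 K)} := by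
  haveI : Fact (Nat.Prime 2) := ⟨Nat.prime_two⟩
  obtain ⟨hQ, hNQ⟩ := q2_mem_primesOver hγ h3
  haveI := hQ.1
  have hQmax : (span {((2 : ℕ) : 𝓞 K),
      thetaInt (aeval_eq hγ) ^ 2 + ((1 : ℤ) : 𝓞 K) * thetaInt (aeval_eq hγ) + ((1 : ℤ) : 𝓞 K)}).IsMaximal :=
    Ring.DimensionLEOne.maximalOfPrime (by
      intro hbot; rw [hbot, Ideal.absNorm_bot] at hNQ; exact absurd hNQ (by norm_num)) hQ.1
  have hne : RingHom.ker ψ₁ ≠ span {((2 : ℕ) : 𝓞 K),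
      thetaInt (aeval_eq hγ) ^ 2 + ((1 : ℤ) : 𝓞 K) * thetaInt (aeval_eq hγ) + ((1 : ℤ) : 𝓞 K)} := by
    intro h
    have h' := congrArg absNorm h
    rw [absNorm_ker_zmod, hNQ] at h'
    exact absurd h' (by norm_num)
  refine span_natCast_eq_mul two_ne_zero (ker_zmod_isMaximal ψ₁) hQmax hne (natCast_mem_ker_zmod ψ₁)
    (Ideal.subset_span (by simp)) ?_
  rw [absNorm_ker_zmod, hNQ, h3]; norm_num

/-! ### §3 The primes above `5`: `(5, γ - 3)` and `𝔮₅ = (5, γ² + 2γ + 3)`; the witness `(-30 - 19γ + δ) = 𝔮₅ · 𝔭₂⁵` -/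

/-- `f ≡ (X - 3)(X² + 2X + 3) (mod 5)`. [cite: Marcus2018, Ch. 3, Thm. 27] -/
theorem polyMod_five : polyMod (-1) 27 36 5 =
    (X - C ((3 : ℤ) : ZMod 5)) * (X ^ 2 + C ((2 : ℤ) : ZMod 5) * X + C ((3 : ℤ) : ZMod 5)) :=
  polyMod_eq_lin_mul_quad_of _ _ _ (by simp only [Cubic.mk.injEq]; decide)

/-- `X² + 2X + 3` has no root mod `5`. [cite: Marcus2018, Ch. 3, Thm. 27] -/
theorem quad_five_ne_zero : ∀ x : ZMod 5, x ^ 2 + ((2 : ℤ) : ZMod 5) * x + ((3 : ℤ) : ZMod 5) ≠ 0 := by decide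

/-- **`𝔮₅ = (5, γ² + 2γ + 3)` is a prime above `5` of norm `25`** (residue degree `2`). [cite: Marcus2018, Ch. 3, Thm. 27] -/
theorem q5_mem_primesOver (hγ : γ ^ 3 - γ ^ 2 + 27 * γ + 36 = 0) (h3 : finrank ℚ K = 3) :
    span {((5 : ℕ) : 𝓞 K), thetaInt (aeval_eq hγ) ^ 2 + ((2 : ℤ) : 𝓞 K) * thetaInt (aeval_eq hγ) + ((3 : ℤ) : 𝓞 K)} ∈
        primesOver (span {((5 : ℕ) : ℤ)}) (𝓞 K) ∧
      absNorm (span {((5 : ℕ) : 𝓞 K),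
        thetaInt (aeval_eq hγ) ^ 2 + ((2 : ℤ) : 𝓞 K) * thetaInt (aeval_eq hγ) + ((3 : ℤ) : 𝓞 K)}) = 5 ^ 2 := by
  haveI : Fact (Nat.Prime 5) := ⟨by norm_num⟩
  exact span_quad_mem_primesOver irreducible_polyQ (aeval_eq hγ) (not_dvd_exponent hγ h3 (p := 5) (by norm_num) (by norm_num))
    quad_five_ne_zero polyMod_five

/-- **The primes above `5` are `𝔭₅ = (5, γ - 3)` and `𝔮₅ = (5, γ² + 2γ + 3)`.** [cite: Marcus2018, Ch. 3, Thm. 27] -/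
theorem eq_span_of_mem_primesOver_five (hγ : γ ^ 3 - γ ^ 2 + 27 * γ + 36 = 0) (h3 : finrank ℚ K = 3)
    {P : Ideal (𝓞 K)} (hP : P ∈ primesOver (span {((5 : ℕ) : ℤ)}) (𝓞 K)) :
    P = span {((5 : ℕ) : 𝓞 K), thetaInt (aeval_eq hγ) - ((3 : ℤ) : 𝓞 K)} ∨
      P = span {((5 : ℕ) : 𝓞 K),
        thetaInt (aeval_eq hγ) ^ 2 + ((2 : ℤ) : 𝓞 K) * thetaInt (aeval_eq hγ) + ((3 : ℤ) : 𝓞 K)} := by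
  haveI : Fact (Nat.Prime 5) := ⟨by norm_num⟩
  exact eq_span_of_polyMod_eq_lin_mul_quad irreducible_polyQ (aeval_eq hγ)
    (not_dvd_exponent hγ h3 (p := 5) (by norm_num) (by norm_num)) quad_five_ne_zero polyMod_five hP

/-- **`(5) = 𝔭₅ · 𝔮₅`** with `𝔭₅ = ker φ` for any `φ : 𝓞 K → ℤ/5` (necessarily `φ(γ) = 3`). [cite: Marcus2018, Ch. 3, Thm. 22] -/
theorem span_five_eq (hγ : γ ^ 3 - γ ^ 2 + 27 * γ + 36 = 0) (h3 : finrank ℚ K = 3) (φ : 𝓞 K →+* ZMod 5) :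
    span {((5 : ℕ) : 𝓞 K)} = RingHom.ker φ *
      span {((5 : ℕ) : 𝓞 K), thetaInt (aeval_eq hγ) ^ 2 + ((2 : ℤ) : 𝓞 K) * thetaInt (aeval_eq hγ) + ((3 : ℤ) : 𝓞 K)} := by
  haveI : Fact (Nat.Prime 5) := ⟨by norm_num⟩
  obtain ⟨hQ, hNQ⟩ := q5_mem_primesOver hγ h3
  haveI := hQ.1
  have hQmax : (span {((5 : ℕ) : 𝓞 K),
      thetaInt (aeval_eq hγ) ^ 2 + ((2 : ℤ) : 𝓞 K) * thetaInt (aeval_eq hγ) + ((3 : ℤ) : 𝓞 K)}).IsMaximal :=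
    Ring.DimensionLEOne.maximalOfPrime (by
      intro hbot; rw [hbot, Ideal.absNorm_bot] at hNQ; exact absurd hNQ (by norm_num)) hQ.1
  have hne : RingHom.ker φ ≠ span {((5 : ℕ) : 𝓞 K),
      thetaInt (aeval_eq hγ) ^ 2 + ((2 : ℤ) : 𝓞 K) * thetaInt (aeval_eq hγ) + ((3 : ℤ) : 𝓞 K)} := by
    intro h
    have h' := congrArg absNorm h
    rw [absNorm_ker_zmod, hNQ] at h'
    exact absurd h' (by norm_num)
  refine span_natCast_eq_mul (by norm_num) (ker_zmod_isMaximal φ) hQmax hne (natCast_mem_ker_zmod φ)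
    (Ideal.subset_span (by simp)) ?_
  rw [absNorm_ker_zmod, hNQ, h3]; norm_num

/-- **`(-30 - 19γ + δ) = 𝔮₅ · 𝔭₂⁵`** (`[𝔮₅] = [𝔭₂]⁻⁵ = [𝔭₂]³`): membership in `𝔮₅` by the explicit combination
`-30 - 19γ + δ = 5·(-132 - 62γ + 11δ) + (γ² + 2γ + 3)·(-8 - 8γ - 7δ)`, in `𝔭₂⁵` by the `2`-adic residue map mod `32`
(`γ ↦ 4`, `δ ↦ 10`), and `|N| = 800 = 25 · 32`. [cite: Marcus2018, Ch. 5, Thm. 35] -/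
theorem span_witness_q5 (hγ : γ ^ 3 - γ ^ 2 + 27 * γ + 36 = 0) (h3 : finrank ℚ K = 3)
    (ψ₁ : 𝓞 K →+* ZMod 2) (h₁ : ψ₁ (thetaInt (aeval_eq hγ)) = 0) :
    span {((-30 : ℤ) : 𝓞 K) + (-19 : ℤ) * thetaInt (aeval_eq hγ) + (1 : ℤ) * thetaInt (delta_root hγ)} =
      span {((5 : ℕ) : 𝓞 K), thetaInt (aeval_eq hγ) ^ 2 + ((2 : ℤ) : 𝓞 K) * thetaInt (aeval_eq hγ) + ((3 : ℤ) : 𝓞 K)} *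
        RingHom.ker ψ₁ ^ 5 := by
  -- finite facts first (before any `Fact` instance is in scope)
  have hr : ((4 : ℤ) : ZMod (2 ^ 5)) ^ 3 + ((-1 : ℤ) : ZMod (2 ^ 5)) * ((4 : ℤ) : ZMod (2 ^ 5)) ^ 2 +
      ((27 : ℤ) : ZMod (2 ^ 5)) * (4 : ℤ) + ((36 : ℤ) : ZMod (2 ^ 5)) = 0 := by decide
  have hs : ((3 : ℕ) : ZMod (2 ^ 5)) * 11 = 1 := by decide
  have hd' : (11 : ZMod (2 ^ 5)) * (((4 : ℤ) : ZMod (2 ^ 5)) ^ 2 - ((4 : ℤ) : ZMod (2 ^ 5)) + 18) = 10 := by decide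
  have hs3 : (11 : ZMod (2 ^ 5)) * 3 = 1 := by decide
  have hc : ((4 : ℤ) : ZMod (2 ^ 5)) = 4 := by decide
  have hx2 : ((-30 : ℤ) : ZMod (2 ^ 5)) + ((-19 : ℤ) : ZMod (2 ^ 5)) * 4 + ((1 : ℤ) : ZMod (2 ^ 5)) * 10 = 0 := by
    decide
  have hcast : ZMod.castHom (dvd_pow_self 2 (by omega : (5 : ℕ) ≠ 0)) (ZMod 2) ((4 : ℤ) : ZMod (2 ^ 5)) = 0 := by
    rw [map_intCast]; decide
  haveI : Fact (Nat.Prime 2) := ⟨Nat.prime_two⟩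
  haveI : Fact (Nat.Prime 5) := ⟨by norm_num⟩
  obtain ⟨hQ, hNQ⟩ := q5_mem_primesOver hγ h3
  haveI := hQ.1
  have hQmax : (span {((5 : ℕ) : 𝓞 K),
      thetaInt (aeval_eq hγ) ^ 2 + ((2 : ℤ) : 𝓞 K) * thetaInt (aeval_eq hγ) + ((3 : ℤ) : 𝓞 K)}).IsMaximal :=
    Ring.DimensionLEOne.maximalOfPrime (by
      intro hbot; rw [hbot, Ideal.absNorm_bot] at hNQ; exact absurd hNQ (by norm_num)) hQ.1
  -- membership in `𝔭₂⁵`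
  obtain ⟨ψ, hψγ, hψδ3⟩ := exists_residueHom_two_pow hγ h3 5 4 hr 11 hs
  have hψδ : ψ (thetaInt (delta_root hγ)) = 10 := by
    have h := congrArg (fun t => (11 : ZMod (2 ^ 5)) * t) hψδ3
    rw [← mul_assoc, hs3, one_mul, hd'] at h
    exact h
  have hker := ker_eq_pow_p2 hγ h3 (k := 5) (by norm_num) ψ (by rw [hψγ]; exact hcast) ψ₁ h₁
  have hx2' : ((-30 : ℤ) : 𝓞 K) + (-19 : ℤ) * thetaInt (aeval_eq hγ) + (1 : ℤ) * thetaInt (delta_root hγ) ∈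
      RingHom.ker ψ₁ ^ 5 := by
    rw [← hker, RingHom.mem_ker]
    simp only [map_add, map_mul, map_intCast, hψγ, hψδ, hc]
    exact hx2
  -- membership in `𝔮₅` by the explicit combination
  have hx5 : ((-30 : ℤ) : 𝓞 K) + (-19 : ℤ) * thetaInt (aeval_eq hγ) + (1 : ℤ) * thetaInt (delta_root hγ) ∈
      span {((5 : ℕ) : 𝓞 K), thetaInt (aeval_eq hγ) ^ 2 + ((2 : ℤ) : 𝓞 K) * thetaInt (aeval_eq hγ) + ((3 : ℤ) : 𝓞 K)} := by
    have hcomb : ((-30 : ℤ) : 𝓞 K) + (-19 : ℤ) * thetaInt (aeval_eq hγ) + (1 : ℤ) * thetaInt (delta_root hγ) =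
        (((-132 : ℤ) : 𝓞 K) + (-62 : ℤ) * thetaInt (aeval_eq hγ) + (11 : ℤ) * thetaInt (delta_root hγ)) *
            ((5 : ℕ) : 𝓞 K) +
          (((-8 : ℤ) : 𝓞 K) + (-8 : ℤ) * thetaInt (aeval_eq hγ) + (-7 : ℤ) * thetaInt (delta_root hγ)) *
            (thetaInt (aeval_eq hγ) ^ 2 + ((2 : ℤ) : 𝓞 K) * thetaInt (aeval_eq hγ) + ((3 : ℤ) : 𝓞 K)) := by
      rw [RingOfIntegers.ext_iff]
      simp only [map_add, map_mul, map_pow, map_intCast, map_natCast, MonicCubic.thetaInt, RingOfIntegers.map_mk]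
      push_cast
      linear_combination ((1 : K) / 3 * (7 * γ + 38)) * hγ
    rw [hcomb]
    exact Ideal.add_mem _ (Ideal.mul_mem_left _ _ (Ideal.subset_span (by simp)))
      (Ideal.mul_mem_left _ _ (Ideal.subset_span (by simp)))
  have hne : span {((5 : ℕ) : 𝓞 K), thetaInt (aeval_eq hγ) ^ 2 + ((2 : ℤ) : 𝓞 K) * thetaInt (aeval_eq hγ) + ((3 : ℤ) : 𝓞 K)}
      ≠ RingHom.ker ψ₁ := by
    intro h
    have h' := congrArg absNorm h
    rw [absNorm_ker_zmod, hNQ] at h'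
    exact absurd h' (by norm_num)
  refine span_singleton_eq_mul_of_mem_of_mem hx5 hx2'
    (by simpa using isCoprime_pow_of_isMaximal_ne hQmax (ker_zmod_isMaximal ψ₁) hne 1 5) ?_ ?_
  · rw [norm_lin3 hγ h3, map_pow, absNorm_ker_zmod, hNQ]; norm_num
  · intro h0
    have h := congrArg (Algebra.norm ℤ) h0
    rw [norm_lin3 hγ h3, Algebra.norm_zero] at h
    norm_num at h

end CubicField14483

end Literature.NumberTheory.NumberFields

end
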